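import Literature.NumberTheory.EllipticCurves.RealLatticePeriodProofs
import Literature.NumberTheory.EllipticCurves.CMChartIdentitiesModel
import Mathlib.Analysis.Calculus.Deriv.Polynomial
import HarnessLib

/-!
# The CM chart identities at a point FROM THE CERTIFICATE SHAPE `P(℘ z) = ℘(αz)·Q(℘ z)` alone: the `x`-shape by substitution, the
# `y`-shape by differentiation (de Shalit II.1.10 / Cox Prop. 14.9 — proofs only)

Topic `NumberTheory/EllipticCurves` (theorems only; no definition, no named fact, no instance).  Cell `bsd-print-cf2`, width seat
`bsd-line-cf2c-w4` g15, brick B7′ of the memo `ALPHA-ASSEMBLY-w4g15.md`.  The point identity `some_add_ptOfZ_evalPt₁_eq_of_cm_identities`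
(`CMFormalActionNilIdealPointsChart`) consumes two identities (X), (Y) among the model coordinates of `Z = ξ(αz)` and `P₁ ⊕ P(t) = ξ(z)`;
`CMChartIdentitiesModel.cmChart_of_certificate` derives them from the certificate pair of `LatticeTransformationIdentity` (needs `h1`, `h2`
of a `CMCert` for the lattice at hand).  This file derives them from the WEAKER certificate shape
`hT : ∀ z ∉ Λ, αz ∉ Λ → P(℘ z) = ℘(αz)·Q(℘ z)` — the shape that TRANSPORTS along homotheties
(`PeriodPair.transformation_of_mulLeft`, so `CMCert.check7` on `(35, −49)` serves the model lattice `(35/4, 49/8)` of `[1,−1,0,−2,−1]`)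
and is the input of the series identities of `CMFormalActionTaylorOfTransformationProofs` / B8:

* `PeriodPair.deriv_transformation_identity` — differentiating `hT` at `z` (`ζ ↦ P(℘ζ) − ℘(αζ)Q(℘ζ)` vanishes near `z`; `HasDerivAt.unique`):
  **`P′(℘ z)·℘′(z) = α·℘′(αz)·Q(℘ z) + ℘(αz)·Q′(℘ z)·℘′(z)`**;
* ★ `PeriodPair.cmChart_of_transformation` — (X) ∧ (Y) in MODEL coordinates read through `φ : A → ℂ` (`P_A^φ = P`, `Q_A^φ = Q`, `φα_A = α`,
  `X₀ + φb = ℘ z`, `2Y₀ + φa₁X₀ + φa₃ = ℘′ z`, same for `Z` at `αz`) — the (X)/(Y) hypotheses of p766205 over `ℂ`; transport to `K̄`/`M_m` by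
  `cmChart_of_map_injective` / `cmChart_map`.

No summit statement is proved; BSD is not proved by any of this.

## References
* [deShalit1987] E. de Shalit, *Iwasawa theory of elliptic curves with complex multiplication* (1987), II §1.10, II §4.9 (ii).
* [Cox2013] D. A. Cox, *Primes of the form x² + ny²*, 2nd ed. (2013), Prop. 14.9 (`α(x, y) = (R(x), α⁻¹R′(x)y)`).
-/

noncomputable section

open Polynomial

namespace PeriodPair

variable (L : PeriodPair)

/-- **Differentiating the certificate shape**: if `P(℘ ζ) = ℘(αζ)·Q(℘ ζ)` for all `ζ ∉ Λ` with `αζ ∉ Λ`, then at such a `z`,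
`P′(℘ z)·℘′(z) = α·℘′(αz)·Q(℘ z) + ℘(αz)·Q′(℘ z)·℘′(z)` (both sides of `hT` are holomorphic near `z`; `ζ ∉ Λ`, `αζ ∉ Λ` are open
conditions). [cite: Cox2013, Prop. 14.9] [cite: deShalit1987, II §1.10] -/
theorem deriv_transformation_identity {α : ℂ} {P Q : ℂ[X]}
    (hT : ∀ z : ℂ, z ∉ L.lattice → α * z ∉ L.lattice → P.eval (℘[L] z) = ℘[L] (α * z) * Q.eval (℘[L] z))
    {z : ℂ} (hz : z ∉ L.lattice) (hαz : α * z ∉ L.lattice) :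
    (derivative P).eval (℘[L] z) * ℘'[L] z =
      α * ℘'[L] (α * z) * Q.eval (℘[L] z) + ℘[L] (α * z) * ((derivative Q).eval (℘[L] z) * ℘'[L] z) := by
  have hopen : IsOpen ((L.lattice : Set ℂ)ᶜ) := L.isClosed_lattice.isOpen_compl
  set Fz : ℂ → ℂ := fun ζ => P.eval (℘[L] ζ) - ℘[L] (α * ζ) * Q.eval (℘[L] ζ) with hFz
  have hFev : Fz =ᶠ[nhds z] fun _ => 0 := by
    have e1 : ∀ᶠ ζ : ℂ in nhds z, ζ ∉ L.lattice := hopen.mem_nhds hz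
    have e2 : ∀ᶠ ζ : ℂ in nhds z, α * ζ ∉ L.lattice := by
      have hc1 : Continuous fun ζ : ℂ => α * ζ := by fun_prop
      exact hc1.continuousAt.preimage_mem_nhds (hopen.mem_nhds hαz)
    filter_upwards [e1, e2] with ζ h1 h2
    simp only [hFz, hT ζ h1 h2, sub_self]
  have hdP : HasDerivAt (fun ζ => P.eval (℘[L] ζ)) ((derivative P).eval (℘[L] z) * ℘'[L] z) z :=
    (P.hasDerivAt (℘[L] z)).comp z (L.hasDerivAt_weierstrassP hz)
  have hdQ : HasDerivAt (fun ζ => Q.eval (℘[L] ζ)) ((derivative Q).eval (℘[L] z) * ℘'[L] z) z :=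
    (Q.hasDerivAt (℘[L] z)).comp z (L.hasDerivAt_weierstrassP hz)
  have hd℘ : HasDerivAt (fun ζ : ℂ => ℘[L] (α * ζ)) (℘'[L] (α * z) * α) z := by
    have e1 : HasDerivAt (fun ζ : ℂ => α * ζ) α z := by simpa using (hasDerivAt_id z).const_mul α
    exact HasDerivAt.comp (h₂ := L.weierstrassP) (h := fun ζ : ℂ => α * ζ) z (L.hasDerivAt_weierstrassP hαz) e1
  have hdF : HasDerivAt Fz ((derivative P).eval (℘[L] z) * ℘'[L] z -
      (℘'[L] (α * z) * α * Q.eval (℘[L] z) + ℘[L] (α * z) * ((derivative Q).eval (℘[L] z) * ℘'[L] z))) z :=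
    hdP.sub (hd℘.mul hdQ)
  have hdF0 : HasDerivAt Fz 0 z := (hasDerivAt_const z (0 : ℂ)).congr_of_eventuallyEq hFev
  have h := hdF.unique hdF0
  linear_combination h

/-- ★ **The chart identities (X), (Y) in MODEL coordinates from the certificate shape.**  For `hT` as above, `z` with `z, αz ∉ Λ`, an
`A`-presentation `P_A, Q_A, α_A` of the data through `φ : A → ℂ`, and the model coordinates `(X₀, Y₀)` of `ξ(z)`, `(x_Z, y_Z)` of `ξ(αz)`
(`x + φb = ℘`, `2y + φa₁·x + φa₃ = ℘′`): the `x`-shape identity `(x_Z + φb)·Q_A(X₀ + φb) = P_A(X₀ + φb)` (= `hT` at `z`) and the `y`-shape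
identity `φα_A·Ỹ_Z·Q_A(X₀+φb) + (x_Z + φb)·Q_A′(X₀+φb)·Ỹ₀ = P_A′(X₀+φb)·Ỹ₀` (= `deriv_transformation_identity`) — the hypotheses (hZx), (hZy) of
`some_add_ptOfZ_evalPt₁_eq_of_cm_identities` read in `ℂ`. [cite: Cox2013, Prop. 14.9] [cite: deShalit1987, II §1.10, II §4.9 (ii)] -/
theorem cmChart_of_transformation {α : ℂ} {P Q : ℂ[X]}
    (hT : ∀ z : ℂ, z ∉ L.lattice → α * z ∉ L.lattice → P.eval (℘[L] z) = ℘[L] (α * z) * Q.eval (℘[L] z))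
    {z : ℂ} (hz : z ∉ L.lattice) (hαz : α * z ∉ L.lattice)
    {A : Type*} [CommRing A] (φ : A →+* ℂ) {PA QA : A[X]} {αA b a₁ a₃ : A}
    (hPA : PA.map φ = P) (hQA : QA.map φ = Q) (hα : φ αA = α)
    {X₀ Y₀ xZ yZ : ℂ} (hX₀ : X₀ + φ b = ℘[L] z) (hY₀ : 2 * Y₀ + φ a₁ * X₀ + φ a₃ = ℘'[L] z)
    (hxZ : xZ + φ b = ℘[L] (α * z)) (hyZ : 2 * yZ + φ a₁ * xZ + φ a₃ = ℘'[L] (α * z)) :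
    (xZ + φ b) * QA.eval₂ φ (X₀ + φ b) = PA.eval₂ φ (X₀ + φ b) ∧
      φ αA * (2 * yZ + φ a₁ * xZ + φ a₃) * QA.eval₂ φ (X₀ + φ b) +
          (xZ + φ b) * (derivative QA).eval₂ φ (X₀ + φ b) * (2 * Y₀ + φ a₁ * X₀ + φ a₃) =
        (derivative PA).eval₂ φ (X₀ + φ b) * (2 * Y₀ + φ a₁ * X₀ + φ a₃) := by
  have hev : ∀ R : A[X], R.eval₂ φ (X₀ + φ b) = (R.map φ).eval (℘[L] z) := fun R => by rw [eval_map, hX₀]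
  rw [hev, hev, hev, hev, ← Polynomial.derivative_map, ← Polynomial.derivative_map, hPA, hQA, hα, hY₀, hxZ, hyZ]
  refine ⟨by rw [hT z hz hαz, mul_comm], ?_⟩
  linear_combination (L.deriv_transformation_identity hT hz hαz).symm

end PeriodPair

end
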